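/- LEAD seat `ym-line-cbag-p1` (prover-ym-line-cbag-p1-g28-0), LINE 7 `GlueballBandRecursion`, item ⟨stmt-QuantumFields-22957⟩
`OneParticleBlochSymbolFamily`: the two PURE shells of the LEAD's skeleton (`…IsolatedBandDefs`) DISCHARGED from the width seats' files —
`SymbolRegularityShell` from w5's `…SymbolRegularity` (`Symbol.symbol_logC2`, `Symbol.norm_inner_toEuclideanLin_le`) and `UpperGapPropagation`
from w3's `…BandUpperGapPropagation` (`traceExcess_sub_le_pow_mul_sub_of_upperGap`).  After this file the skeleton of the item has exactly
ONE open stub, `IsolatedBandFrame`.  Definition-free; route-independent. -/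
import Summits.QuantumFields.YangMills.Theorems.GlueballBandRecursionIsolatedBandDefs
import Summits.QuantumFields.YangMills.Theorems.GlueballBandRecursionSymbolRegularity
import Summits.QuantumFields.YangMills.Theorems.GlueballBandRecursionBandUpperGapPropagation

/-!
# Route `GlueballBandRecursion`, item `OneParticleBlochSymbolFamily` (stmt-QuantumFields-22957): the shells `SymbolRegularityShell` and
# `UpperGapPropagation` hold

* `upperGapPropagation_holds : UpperGapPropagation` — the window gives `q_N < 1` (`rate_lt_one_of_strongCoupling`), the isolation clause of
  the skeleton is the upper gap `Θ = δ·q_min·λ₊` of `…BandUpperGapPropagation`, and `Θ/λ₊ = δ q_min`.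
* `symbolRegularityShell_holds : SymbolRegularityShell` — the symmetrised symbol `kernelSymbol J = ½(S_J + S_Jᴴ)` (`…TransferSymbol`) is a
  finite trigonometric sum in the sense of `…SymbolRegularity` over the index `Site 3 N ⊕ Site 3 N` (hopping vectors `∓z̃`, matrices
  `½J(z)`, `½J(z)ᴴ`, `kernelSymbol_eq_trigSum`); (P1) `R_u ≥ (1 − θ)s` directly from diagonal dominance (`le_re_inner_kernelSymbol`); (P2) from
  `Symbol.symbol_logC2` with the entrywise majorants `a = ½‖J(z)‖₁`, whose constant `M₂/r₀ + M₀M₂/r₀²` is at most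
  `K(θ, M) = M/(1−θ) + (M+θ)M/(1−θ)²` under the shell's relative bounds (the scale `s` cancels).

HONEST FRAMING.  Pure real analysis / spectral bookkeeping adapters; the XL stub `IsolatedBandFrame`, the item, the rung
`ColdDoublingRecursionStrongCoupling` and the Yang–Mills mass gap are NOT proved or advanced here.
-/

set_option autoImplicit false

noncomputable section

open scoped InnerProductSpace BigOperators ComplexConjugate Matrix
open Finset MeasureTheory Complex
open Literature.MathematicalPhysics.QuantumFieldTheory
open Literature.MathematicalPhysics.QuantumFieldTheory.Balaban1983to89.Missing (strongCouplingRadius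
  transferSpectralRadius_pos_of_unitary)

namespace Summit.QuantumFields.YangMills.Theorems.GlueballBandRecursion.Band

/-! ### §1 `UpperGapPropagation` from `…BandUpperGapPropagation` -/

/-- **The shell `UpperGapPropagation` holds.** -/
theorem upperGapPropagation_holds : UpperGapPropagation := by
  intro G _ _ _ _
  letI : MeasurableSpace G := borel G
  haveI : BorelSpace G := ⟨rfl⟩
  intro r β hβ0 hβ N _ n e μ qmin δ he hμ hqmin hδ0 hδ1 hfloor hlt hiso s t hst
  haveI : SecondCountableTopology G :=
    (r.continuous.isClosedEmbedding r.injective).isEmbedding.secondCountableTopology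
  have hq := rate_lt_one_of_strongCoupling r hβ0 hβ N
  have hLpos : 0 < transferSpectralRadius r.ρ β N :=
    transferSpectralRadius_pos_of_unitary r.ρ r.continuous r.mem_unitary hβ0 N
  have hgap : ∀ (v : Lp ℝ 2 (Measure.pi fun _ : Edge 3 N => haarProbability G)) (l : ℝ), v ≠ 0 →
      wilsonTorusTransferMatrix r.ρ β N v = l • v → l < transferSpectralRadius r.ρ β N →
      (∀ k, ⟪e k, v⟫_ℝ = 0) → l ≤ δ * qmin * transferSpectralRadius r.ρ β N := by
    intro v l hv hTv hl horth
    rcases hiso v l hTv horth with h | h | h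
    · exact absurd h hv
    · exact absurd h hl.ne
    · exact h
  have h := traceExcess_sub_le_pow_mul_sub_of_upperGap r hβ0 N hq e he μ hμ hlt hgap hst
  have hΘ : δ * qmin * transferSpectralRadius r.ρ β N / transferSpectralRadius r.ρ β N = δ * qmin := by
    field_simp
  rw [hΘ] at h
  exact h

/-! ### §2 `SymbolRegularityShell` from `…SymbolRegularity` -/

section Symbol

variable {N : ℕ} {n : ℕ}

/-- The centred phase in `…SymbolRegularity`'s format. -/
theorem sitePhase_eq_cexp (q : Fin 3 → ℝ) (z : Site 3 N) :
    sitePhase q z = cexp (((-(∑ i, q i * ((-((z i).valMinAbs) : ℤ) : ℝ)) : ℝ) : ℂ) * I) := by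
  unfold sitePhase
  congr 1
  push_cast
  simp only [mul_neg, Finset.sum_neg_distrib, neg_neg]
  ring

/-- The conjugate phase. -/
theorem conj_sitePhase_eq_cexp (q : Fin 3 → ℝ) (z : Site 3 N) :
    conj (sitePhase q z) = cexp (((-(∑ i, q i * (((z i).valMinAbs : ℤ) : ℝ)) : ℝ) : ℂ) * I) := by
  unfold sitePhase
  rw [← Complex.exp_conj, map_mul, Complex.conj_I, Complex.conj_ofReal]
  congr 1
  push_cast
  ring

/-- The hopping vectors of the two halves of the symmetrised symbol: `−z̃` for `S_J`, `+z̃` for `S_Jᴴ`. -/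
def hopVec (y : Site 3 N ⊕ Site 3 N) : Fin 3 → ℤ :=
  Sum.elim (fun z i => -((z i).valMinAbs)) (fun z i => (z i).valMinAbs) y

/-- The hopping matrices of the two halves: `½J(z)` and `½J(z)ᴴ`. -/
def hopMat (J : Site 3 N → Matrix (Fin n) (Fin n) ℝ) (y : Site 3 N ⊕ Site 3 N) : Matrix (Fin n) (Fin n) ℂ :=
  Sum.elim (fun z => (1 / 2 : ℂ) • (J z).map Complex.ofReal) (fun z => (1 / 2 : ℂ) • ((J z).map Complex.ofReal)ᴴ) y

/-- Entrywise ℓ¹ mass of the complexified kernel equals `entryNorm`. -/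
theorem sum_norm_map_ofReal (A : Matrix (Fin n) (Fin n) ℝ) : ∑ j, ∑ k, ‖(A.map Complex.ofReal) j k‖ = entryNorm A := by
  simp only [Matrix.map_apply, Complex.norm_real, Real.norm_eq_abs, entryNorm]

/-- `‖½‖ = ½` in `ℂ`. -/
theorem norm_one_half_complex : ‖(1 / 2 : ℂ)‖ = 1 / 2 := by
  rw [norm_div, norm_one, Complex.norm_two]

/-- The majorants `a_y = ½‖J(z)‖₁` of the halves. -/
theorem norm_inner_hopMat_le (J : Site 3 N → Matrix (Fin n) (Fin n) ℝ) (u : EuclideanSpace ℂ (Fin n)) (hu : ‖u‖ = 1)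
    (y : Site 3 N ⊕ Site 3 N) :
    ‖⟪u, Matrix.toEuclideanLin (hopMat J y) u⟫_ℂ‖ ≤ Sum.elim (fun z => entryNorm (J z) / 2) (fun z => entryNorm (J z) / 2) y := by
  rcases y with z | z
  · simp only [hopMat, Sum.elim_inl]
    refine (Symbol.norm_inner_toEuclideanLin_le _ u hu).trans (le_of_eq ?_)
    rw [entryNorm, Finset.sum_div]
    refine Finset.sum_congr rfl fun j _ => ?_
    rw [Finset.sum_div]
    refine Finset.sum_congr rfl fun k _ => ?_
    rw [Matrix.smul_apply, smul_eq_mul, norm_mul, norm_one_half_complex, Matrix.map_apply, Complex.norm_real, Real.norm_eq_abs]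
    ring
  · simp only [hopMat, Sum.elim_inr]
    refine (Symbol.norm_inner_toEuclideanLin_le _ u hu).trans (le_of_eq ?_)
    rw [entryNorm, Finset.sum_comm, Finset.sum_div]
    refine Finset.sum_congr rfl fun j _ => ?_
    rw [Finset.sum_div]
    refine Finset.sum_congr rfl fun k _ => ?_
    rw [Matrix.smul_apply, smul_eq_mul, norm_mul, norm_one_half_complex, Matrix.conjTranspose_apply, Matrix.map_apply,
      Complex.star_def, Complex.norm_conj, Complex.norm_real, Real.norm_eq_abs]
    ring

/-- `|z̃|₂² ≤ |z̃|₁²`. -/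
theorem sum_valMinAbs_sq_le_siteSize_sq (z : Site 3 N) :
    (∑ i : Fin 3, (((z i).valMinAbs : ℤ) : ℝ) ^ 2) ≤ (siteSize z : ℝ) ^ 2 := by
  have h : ∀ i : Fin 3, (((z i).valMinAbs : ℤ) : ℝ) ^ 2 = ((((z i).valMinAbs).natAbs : ℕ) : ℝ) ^ 2 := by
    intro i
    rw [← Int.cast_natCast, Int.natCast_natAbs, Int.cast_abs, sq_abs]
  simp_rw [h]
  rw [siteSize]
  push_cast
  exact Finset.sum_sq_le_sq_sum_of_nonneg fun i _ => by positivity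

variable [NeZero N]

/-- **The symmetrised symbol is a finite trigonometric sum** over `Site 3 N ⊕ Site 3 N` in the format of `…SymbolRegularity`. -/
theorem kernelSymbol_eq_trigSum (J : Site 3 N → Matrix (Fin n) (Fin n) ℝ) (q : Fin 3 → ℝ) :
    kernelSymbol J q = ∑ y, cexp (((-(∑ i, q i * (hopVec y i : ℝ)) : ℝ) : ℂ) * I) • hopMat J y := by
  rw [Fintype.sum_sum_type]
  simp only [hopVec, hopMat, Sum.elim_inl, Sum.elim_inr]
  rw [kernelSymbol, kernelTrigSum, smul_add, Matrix.conjTranspose_sum, Finset.smul_sum, Finset.smul_sum]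
  congr 1
  · refine Finset.sum_congr rfl fun z _ => ?_
    rw [smul_comm, sitePhase_eq_cexp]
  · refine Finset.sum_congr rfl fun z _ => ?_
    rw [Matrix.conjTranspose_smul, Complex.star_def, conj_sitePhase_eq_cexp, smul_comm]

/-- **(P1) from diagonal dominance**: `Re⟪u, B̃_J(q) u⟫ ≥ s − Σ_{z ≠ 0} ‖J(z)‖₁` for a unit `u` when `Re⟪u, J(0)u⟫ ≥ s`. -/
theorem le_re_inner_kernelSymbol (J : Site 3 N → Matrix (Fin n) (Fin n) ℝ) {s : ℝ}
    (hons : ∀ u : EuclideanSpace ℂ (Fin n), s * ‖u‖ ^ 2 ≤ RCLike.re ⟪u, Matrix.toEuclideanLin ((J 0).map Complex.ofReal) u⟫_ℂ)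
    (u : EuclideanSpace ℂ (Fin n)) (hu : ‖u‖ = 1) (q : Fin 3 → ℝ) :
    s - ∑ z ∈ Finset.univ.erase 0, entryNorm (J z) ≤ RCLike.re ⟪u, Matrix.toEuclideanLin (kernelSymbol J q) u⟫_ℂ := by
  classical
  rw [re_inner_kernelSymbol, re_inner_kernelTrigSum, ← Finset.add_sum_erase _ _ (Finset.mem_univ (0 : Site 3 N))]
  have h0 : sitePhase q (0 : Site 3 N) = 1 := by
    unfold sitePhase
    simp [ZMod.valMinAbs_zero]
  have hon : s ≤ RCLike.re (sitePhase q (0 : Site 3 N) * ⟪u, Matrix.toEuclideanLin ((J 0).map Complex.ofReal) u⟫_ℂ) := by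
    rw [h0, one_mul]
    have := hons u
    rwa [hu, one_pow, mul_one] at this
  have hoff : ∀ z ∈ Finset.univ.erase (0 : Site 3 N),
      -entryNorm (J z) ≤ RCLike.re (sitePhase q z * ⟪u, Matrix.toEuclideanLin ((J z).map Complex.ofReal) u⟫_ℂ) := by
    intro z _
    have h1 : ‖sitePhase q z * ⟪u, Matrix.toEuclideanLin ((J z).map Complex.ofReal) u⟫_ℂ‖ ≤ entryNorm (J z) := by
      rw [norm_mul]
      have hph : ‖sitePhase q z‖ = 1 := by
        unfold sitePhase
        rw [mul_comm, Complex.norm_exp_ofReal_mul_I]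
      rw [hph, one_mul, ← sum_norm_map_ofReal]
      exact Symbol.norm_inner_toEuclideanLin_le _ u hu
    have h2 := (RCLike.re_le_norm (K := ℂ) (-(sitePhase q z * ⟪u, Matrix.toEuclideanLin ((J z).map Complex.ofReal) u⟫_ℂ)))
    rw [map_neg, norm_neg] at h2
    linarith
  have hsum := Finset.sum_le_sum hoff
  rw [Finset.sum_neg_distrib] at hsum
  linarith

/-- **The shell `SymbolRegularityShell` holds**, with `K(θ, M) = M/(1−θ) + (M+θ)M/(1−θ)²`. -/
theorem symbolRegularityShell_holds : SymbolRegularityShell := by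
  intro θ M hθ0 hθ1 hM0
  have h1θ : 0 < 1 - θ := by linarith
  refine ⟨M / (1 - θ) + (M + θ) * M / (1 - θ) ^ 2, by positivity, ?_⟩
  intro N _ n J s hs hrefl hons hoff hon0 hmom2 u hu
  classical
  -- the floor `r₀ = (1 − θ)s`
  have hr₀ : 0 < (1 - θ) * s := mul_pos h1θ hs
  have hP1 : ∀ u' : EuclideanSpace ℂ (Fin n), ‖u'‖ = 1 → ∀ q,
      (1 - θ) * s ≤ RCLike.re ⟪u', Matrix.toEuclideanLin (kernelSymbol J q) u'⟫_ℂ := by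
    intro u' hu' q
    have h := le_re_inner_kernelSymbol J hons u' hu' q
    nlinarith
  refine ⟨fun q => hr₀.trans_le (hP1 u hu q), fun x v => ?_⟩
  -- (P2) via `Symbol.symbol_logC2` on the `⊕`-representation
  have hlog := Symbol.symbol_logC2 (hopVec (N := N)) (hopMat J) (kernelSymbol J) (kernelSymbol_eq_trigSum J)
    (a := Sum.elim (fun z => entryNorm (J z) / 2) (fun z => entryNorm (J z) / 2)) (norm_inner_hopMat_le J) hr₀ hP1 u hu x v
  -- the constant of `symbol_logC2` is at most `K(θ, M)`
  have hM₀ : (∑ y, Sum.elim (fun z => entryNorm (J z) / 2) (fun z => entryNorm (J z) / 2) y) ≤ (M + θ) * s := by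
    rw [Fintype.sum_sum_type]
    simp only [Sum.elim_inl, Sum.elim_inr]
    rw [← Finset.sum_add_distrib]
    have h : ∑ z, (entryNorm (J z) / 2 + entryNorm (J z) / 2) = ∑ z, entryNorm (J z) :=
      Finset.sum_congr rfl fun z _ => by ring
    rw [h, ← Finset.add_sum_erase _ _ (Finset.mem_univ (0 : Site 3 N))]
    linarith
  have hM₂ : (∑ y, Sum.elim (fun z => entryNorm (J z) / 2) (fun z => entryNorm (J z) / 2) y *
      ∑ i, (hopVec (N := N) y i : ℝ) ^ 2) ≤ M * s := by
    rw [Fintype.sum_sum_type]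
    simp only [Sum.elim_inl, Sum.elim_inr, hopVec]
    have hsq : ∀ z : Site 3 N, (∑ i : Fin 3, (((-((z i).valMinAbs) : ℤ) : ℝ)) ^ 2) = ∑ i : Fin 3, ((((z i).valMinAbs : ℤ)) : ℝ) ^ 2 :=
      fun z => Finset.sum_congr rfl fun i _ => by push_cast; ring
    simp_rw [hsq]
    rw [← Finset.sum_add_distrib]
    have h : ∑ z, (entryNorm (J z) / 2 * ∑ i : Fin 3, ((((z i).valMinAbs : ℤ)) : ℝ) ^ 2 +
        entryNorm (J z) / 2 * ∑ i : Fin 3, ((((z i).valMinAbs : ℤ)) : ℝ) ^ 2) =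
        ∑ z, (∑ i : Fin 3, ((((z i).valMinAbs : ℤ)) : ℝ) ^ 2) * entryNorm (J z) :=
      Finset.sum_congr rfl fun z _ => by ring
    rw [h]
    refine le_trans (Finset.sum_le_sum fun z _ => ?_) hmom2
    have hE : 0 ≤ entryNorm (J z) := Finset.sum_nonneg fun i _ => Finset.sum_nonneg fun j _ => abs_nonneg _
    exact mul_le_mul_of_nonneg_right (sum_valMinAbs_sq_le_siteSize_sq z) hE
  have hE0 : ∀ z : Site 3 N, 0 ≤ entryNorm (J z) := fun z => Finset.sum_nonneg fun i _ => Finset.sum_nonneg fun j _ => abs_nonneg _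
  have hM₀nn : 0 ≤ ∑ y, Sum.elim (fun z => entryNorm (J z) / 2) (fun z => entryNorm (J z) / 2) y :=
    Finset.sum_nonneg fun y _ => by rcases y with z | z <;> simp only [Sum.elim_inl, Sum.elim_inr] <;> linarith [hE0 z]
  have hM₂nn : 0 ≤ ∑ y, Sum.elim (fun z => entryNorm (J z) / 2) (fun z => entryNorm (J z) / 2) y *
      ∑ i, (hopVec (N := N) y i : ℝ) ^ 2 :=
    Finset.sum_nonneg fun y _ => mul_nonneg (by rcases y with z | z <;> simp only [Sum.elim_inl, Sum.elim_inr] <;> linarith [hE0 z])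
      (Finset.sum_nonneg fun i _ => sq_nonneg _)
  set A := ∑ y, Sum.elim (fun z => entryNorm (J z) / 2) (fun z => entryNorm (J z) / 2) y *
      ∑ i, (hopVec (N := N) y i : ℝ) ^ 2 with hA
  set B := ∑ y, Sum.elim (fun z => entryNorm (J z) / 2) (fun z => entryNorm (J z) / 2) y with hB
  have hK : A / ((1 - θ) * s) + B * A / ((1 - θ) * s) ^ 2 ≤ M / (1 - θ) + (M + θ) * M / (1 - θ) ^ 2 := by
    have h1 : A / ((1 - θ) * s) ≤ M / (1 - θ) := by
      rw [div_le_div_iff₀ hr₀ h1θ]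
      nlinarith
    have h2 : B * A / ((1 - θ) * s) ^ 2 ≤ (M + θ) * M / (1 - θ) ^ 2 := by
      rw [div_le_div_iff₀ (pow_pos hr₀ 2) (pow_pos h1θ 2)]
      have hBA : B * A ≤ (M + θ) * s * (M * s) := mul_le_mul hM₀ hM₂ hM₂nn (by positivity)
      nlinarith
    linarith
  have hv : 0 ≤ ∑ i, v i ^ 2 := Finset.sum_nonneg fun i _ => sq_nonneg _
  have hmono : (M / (1 - θ) + (M + θ) * M / (1 - θ) ^ 2) * ∑ i, v i ^ 2 ≥
      (A / ((1 - θ) * s) + B * A / ((1 - θ) * s) ^ 2) * ∑ i, v i ^ 2 := mul_le_mul_of_nonneg_right hK hv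
  linarith [hlog]

end Symbol

end Summit.QuantumFields.YangMills.Theorems.GlueballBandRecursion.Band

end
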